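import Mathlib
import Summits.ValiantsHypothesis.ValiantsHypothesis.Theorems.GrenetZeonTwoDimCoefficientsScalingPermPointHessian

/-!
# Crux `GrenetZeon.TwoDimCoefficients` (stmt-ValiantsHypothesis-8062) / rung `DualUnipotentThreeHalves` (stmt-24318):
# scaling-closure — PER-GENERICITY AT MONOMIAL POINTS (the torus orbits of the permutation points)

Third explicit family of FULL-RANK points of the Hessian of the permanent (after ✓ `rank_hess0_transl_permPoint_perPoly` p836772
and ✓ `rank_hess0_transl_rankOne_perPoly` p837075): the MONOMIAL points `x_{r,c} = t_c·[r = τ c]` with all `t_c ≠ 0` — the torus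
orbit of the permutation matrix of `τ`.  A linear form with two non-zero coefficients in general position (distinct rows AND
distinct columns) vanishes at such a point, which is the generic case of PG(1) (memo NINETEENTH-HAND.md §3).

* ★ `hess0_transl_monomialPoint_perPoly_apply` — `Hess per_n (P_τ^t)_{(c,d),(a,b)} = H⁰_{(c,d),(a,b)} · ∏_{i ∉ {b,d}} t_i` with
  `H⁰` the `0/1` pattern of the permutation point (✓ `hess0_transl_permPoint_perPoly_apply`);
* ★ `hess0_transl_monomialPoint_perPoly_eq_smul` — `Hess per_n (P_τ^t) = (∏ t) · D · Hess per_n (P_τ) · D`, `D = diag(t_{col}⁻¹)`;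
* ★★ `rank_hess0_transl_monomialPoint_perPoly` — `rank Hess per_n (P_τ^t) = n²` for `n ≥ 2`, all `t_c ≠ 0`.

HONEST FRAMING: an unconditional, route-independent computation about the permanent (no Theses import); it closes no stub:
`DualUnipotentBound`, crux 8062, the 24318 decl and `VP ≠ VNP` remain open.

References: T. Mignon, N. Ressayre, Int. Math. Res. Not. 2004:79, §3 (via the tree); J. M. Landsberg, *Geometry and Complexity
Theory* (2017), §6.4.6; M. Marcus, F. May, Illinois J. Math. 6 (1962) (the torus in the stabiliser of `per_n`); folklore.
-/

-- single-conjunct layout `Summits/ValiantsHypothesis/ValiantsHypothesis`: the duplicated namespace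
-- component is mandated by the tree.
set_option linter.dupNamespace false
set_option autoImplicit false

noncomputable section

namespace Summit.ValiantsHypothesis.ValiantsHypothesis.Theorems.GrenetZeonTwoDimCoefficients.ScalingClosure

open MvPolynomial Matrix
open Literature.Computability.AlgebraicComplexity
open Summit.ValiantsHypothesis.ValiantsHypothesis.Cruxes.TwoDimCoefficients.DimTwoCases

section MonomialPoint

variable {n : ℕ}

/-- ★ **The Hessian of `per_n` at a monomial point** `x_{r,c} = t_c·[r = τ c]`: the permutation-point pattern times
`∏_{i ∉ {b,d}} t_i`. [cite: MignonRessayre2004, §3 — via the tree; folklore] -/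
theorem hess0_transl_monomialPoint_perPoly_apply (τ : Equiv.Perm (Fin n)) (t : Fin n → ℂ) (a b c d : Fin n) :
    hess0 (transl (fun u : Fin n × Fin n => if u.1 = τ u.2 then t u.2 else 0) (perPoly (Fin n) ℂ)) (c, d) (a, b) =
      (if d ≠ b ∧ ((a = τ b ∧ c = τ d) ∨ (a = τ d ∧ c = τ b)) then 1 else 0) *
        ∏ i ∈ (Finset.univ.erase b).erase d, t i := by
  classical
  rw [hess0_transl_perPoly]
  -- the product along `π` off `{b, d}` is the indicator of «`π` agrees with `τ` off `{b, d}`»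
  have hprod : ∀ π : Equiv.Perm (Fin n),
      (∏ i ∈ (Finset.univ.erase b).erase d, (fun u : Fin n × Fin n => if u.1 = τ u.2 then t u.2 else 0) (π i, i)) =
        if (∀ i, i ≠ b → i ≠ d → π i = τ i) then (∏ i ∈ (Finset.univ.erase b).erase d, t i) else 0 := by
    intro π
    by_cases h : ∀ i, i ≠ b → i ≠ d → π i = τ i
    · rw [if_pos h]
      refine Finset.prod_congr rfl fun i hi => ?_
      have hi' : i ≠ d ∧ i ≠ b := by simpa [Finset.mem_erase] using hi
      dsimp only
      rw [if_pos (h i hi'.2 hi'.1)]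
    · rw [if_neg h]
      push Not at h
      obtain ⟨i, hib, hid, hne⟩ := h
      refine Finset.prod_eq_zero (i := i) (by simp [Finset.mem_erase, hib, hid]) ?_
      dsimp only
      rw [if_neg hne]
  simp_rw [hprod]
  by_cases hdb : d ≠ b
  · -- only `τ` and `τ ∘ (b d)` contribute
    have hne : τ ≠ τ * Equiv.swap b d := by
      intro h
      have h1 : Equiv.swap b d = 1 := mul_eq_left.mp h.symm
      exact hdb (Equiv.swap_eq_refl_iff.mp h1).symm
    -- the two (mutually exclusive) patterns
    have hexcl : ¬ ((a = τ b ∧ c = τ d) ∧ (a = τ d ∧ c = τ b)) := by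
      rintro ⟨⟨h1, -⟩, ⟨h2, -⟩⟩
      exact hdb (τ.injective (h2.symm.trans h1))
    -- the term at `τ`
    set P : ℂ := ∏ i ∈ (Finset.univ.erase b).erase d, t i with hP
    have hτ : (if τ b = a ∧ d ≠ b ∧ τ d = c then
        (if (∀ i, i ≠ b → i ≠ d → τ i = τ i) then P else 0) else 0) =
        if (a = τ b ∧ c = τ d) then P else 0 := by
      rw [if_pos (fun _ _ _ => rfl)]
      by_cases h : a = τ b ∧ c = τ d
      · rw [if_pos ⟨h.1.symm, hdb, h.2.symm⟩, if_pos h]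
      · rw [if_neg (fun h' => h ⟨h'.1.symm, h'.2.2.symm⟩), if_neg h]
    -- the term at `τ ∘ (b d)`
    have hgσ : ∀ i, i ≠ b → i ≠ d → (τ * Equiv.swap b d) i = τ i := fun i h1 h2 => by
      rw [Equiv.Perm.mul_apply, Equiv.swap_apply_of_ne_of_ne h1 h2]
    have hσb : (τ * Equiv.swap b d) b = τ d := by
      rw [Equiv.Perm.mul_apply, Equiv.swap_apply_left]
    have hσd : (τ * Equiv.swap b d) d = τ b := by
      rw [Equiv.Perm.mul_apply, Equiv.swap_apply_right]
    have hσ : (if (τ * Equiv.swap b d) b = a ∧ d ≠ b ∧ (τ * Equiv.swap b d) d = c then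
        (if (∀ i, i ≠ b → i ≠ d → (τ * Equiv.swap b d) i = τ i) then P else 0) else 0) =
        if (a = τ d ∧ c = τ b) then P else 0 := by
      rw [if_pos hgσ, hσb, hσd]
      by_cases h : a = τ d ∧ c = τ b
      · rw [if_pos ⟨h.1.symm, hdb, h.2.symm⟩, if_pos h]
      · rw [if_neg (fun h' => h ⟨h'.1.symm, h'.2.2.symm⟩), if_neg h]
    rw [← Finset.sum_subset (Finset.subset_univ ({τ, τ * Equiv.swap b d} : Finset _)),
      Finset.sum_pair hne]
    · -- evaluate the two terms
      rw [hτ, hσ]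
      by_cases h1 : a = τ b ∧ c = τ d
      · have h2 : ¬ (a = τ d ∧ c = τ b) := fun h2 => hexcl ⟨h1, h2⟩
        rw [if_pos h1, if_neg h2, if_pos ⟨hdb, Or.inl h1⟩, add_zero, one_mul]
      · by_cases h2 : a = τ d ∧ c = τ b
        · rw [if_neg h1, if_pos h2, if_pos ⟨hdb, Or.inr h2⟩, zero_add, one_mul]
        · rw [if_neg h1, if_neg h2, if_neg (fun h => h.2.elim h1 h2), add_zero, zero_mul]
    · intro π _ hπ
      by_cases hP : π b = a ∧ d ≠ b ∧ π d = c
      · rw [if_pos hP, if_neg]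
        intro hall
        apply hπ
        rcases perm_eq_or_eq_mul_swap_of_agree π τ (Ne.symm hdb) hall with rfl | rfl
        · simp
        · simp
      · rw [if_neg hP]
  · -- `d = b`: everything vanishes
    rw [if_neg (fun h => hdb h.1), zero_mul]
    refine Finset.sum_eq_zero fun π _ => ?_
    rw [if_neg]
    rintro ⟨-, h, -⟩
    exact hdb h


/-- ★ **Factorisation**: `Hess per_n (P_τ^t) = (∏_c t_c) · D · Hess per_n (P_τ) · D` with `D = diag((a,b) ↦ t_b⁻¹)`, for all
`t_c ≠ 0`. [folklore] -/
theorem hess0_transl_monomialPoint_perPoly_eq_smul (τ : Equiv.Perm (Fin n)) (t : Fin n → ℂ) (ht : ∀ c, t c ≠ 0) :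
    hess0 (transl (fun u : Fin n × Fin n => if u.1 = τ u.2 then t u.2 else 0) (perPoly (Fin n) ℂ)) =
      (∏ c, t c) • (Matrix.diagonal (fun s : Fin n × Fin n => (t s.2)⁻¹) *
        hess0 (transl (fun u : Fin n × Fin n => if u.1 = τ u.2 then (1 : ℂ) else 0) (perPoly (Fin n) ℂ)) *
        Matrix.diagonal (fun s : Fin n × Fin n => (t s.2)⁻¹)) := by
  classical
  ext ⟨c, d⟩ ⟨a, b⟩
  rw [hess0_transl_monomialPoint_perPoly_apply, Matrix.smul_apply, Matrix.mul_diagonal, Matrix.diagonal_mul,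
    hess0_transl_permPoint_perPoly_apply, smul_eq_mul]
  by_cases h : d ≠ b ∧ ((a = τ b ∧ c = τ d) ∨ (a = τ d ∧ c = τ b))
  · rw [if_pos h, one_mul, mul_one]
    have htb : (∏ i ∈ (Finset.univ.erase b).erase d, t i) * t d * t b = ∏ i, t i := by
      rw [Finset.prod_erase_mul _ _ (Finset.mem_erase.mpr ⟨h.1, Finset.mem_univ d⟩),
        Finset.prod_erase_mul _ _ (Finset.mem_univ b)]
    have h2 : t d * t b ≠ 0 := mul_ne_zero (ht d) (ht b)
    have htb' : (∏ i ∈ (Finset.univ.erase b).erase d, t i) = (∏ i, t i) / (t d * t b) := by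
      rw [eq_div_iff h2, ← htb, mul_assoc]
    rw [htb']
    field_simp
  · rw [if_neg h, zero_mul, mul_zero, zero_mul, mul_zero]

/-- ★★ **Every monomial point with non-zero weights is a full-rank point of the Hessian of the permanent**: for `n ≥ 2` and all
`t_c ≠ 0`, `rank Hess per_n (t_c·[r = τ c]) = n²`. [cite: MignonRessayre2004, §3 — via the tree; folklore] -/
theorem rank_hess0_transl_monomialPoint_perPoly (hn : 2 ≤ n) (τ : Equiv.Perm (Fin n)) (t : Fin n → ℂ)
    (ht : ∀ c, t c ≠ 0) :
    (hess0 (transl (fun u : Fin n × Fin n => if u.1 = τ u.2 then t u.2 else 0) (perPoly (Fin n) ℂ))).rank = n ^ 2 := by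
  classical
  rw [hess0_transl_monomialPoint_perPoly_eq_smul τ t ht,
    rank_smul_eq (Finset.prod_ne_zero_iff.mpr fun c _ => ht c)]
  have hD : IsUnit (Matrix.diagonal (fun s : Fin n × Fin n => (t s.2)⁻¹)).det := by
    rw [Matrix.det_diagonal]
    exact isUnit_iff_ne_zero.mpr (Finset.prod_ne_zero_iff.mpr fun s _ => inv_ne_zero (ht s.2))
  rw [Matrix.rank_mul_eq_left_of_isUnit_det _ _ hD, Matrix.rank_mul_eq_right_of_isUnit_det _ _ hD,
    rank_hess0_transl_permPoint_perPoly hn τ]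

end MonomialPoint

end Summit.ValiantsHypothesis.ValiantsHypothesis.Theorems.GrenetZeonTwoDimCoefficients.ScalingClosure

end
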